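import Summits.BirchSwinnertonDyer.BirchSwinnertonDyer.Theorems.Rank1ResidualJetKolyvaginFrobeniusTorsion
import Summits.BirchSwinnertonDyer.BirchSwinnertonDyer.Theorems.GenusKolyvaginAtTwoK4NegLwClassLevelTwoValues
import Summits.BirchSwinnertonDyer.BirchSwinnertonDyer.Theorems.GenusKolyvaginAtTwoGenusPrimitiveSupplyAtTwoTwistingPrimeLevelFourClassFrobenius
import HarnessLib

/-!
# Route `GenusKolyvaginAtTwo`, crux K₄⁻ `K4Neg` (stmt-BirchSwinnertonDyer-31526), LINE 34 «twin_bsd_road⁻», phantom cell F4ᵖᵍ —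
# THE TRACE BIT: `[ξ_E, F·F] = 0 ⟺ loc_ℓ ξ_E = 0 ⟺ 4 ∣ a_ℓ(E)` for the Lawson–Wuthrich class at a transposition prime

Width seat `bsd-line-gk2-p4` g34 (cell `bsd-f1-sign2`), WIDTH-5 attach on route `GenusKolyvaginAtTwo` rev 59, lane «the 2-adic / phantom bit».
`--supports stmt-BirchSwinnertonDyer-31526 --as helper`.  THEOREMS ONLY (no definition, no named fact, no `sorry`); standard axioms.
**BSD is NOT proved by this file; `K4Neg` is NOT proved; no item is closed by it.**

WHY.  On the phantom cell F4ᵖᵍ of K₄⁻ (off the cut, not multiplicative at `2`) the LEAD's road (gk2-p1 g28 `…K4NegPhantomCellTopBits`: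
WALL + U₂ + Q2 + PRINT + the pair-separation / Heegner descent bit `hDesc`) needs, at the prime Heegner frame `K = ℚ(√−ℓ₀)`, that the
Lawson–Wuthrich class `ξ_E ∈ H¹(ℚ, E[2])` (the unique non-zero class dying on `Γ_{ℚ(E[4])}`) is NOT the Kummer class of the twin's
generator — which gk2-p3 g34 (`…K4NegPhantomCellDescentBitSupply`) reads as «`[ξ_E, F·F] ≠ 0`» for an arithmetic Frobenius `F` at `ℓ₀`
(⟺ `loc_{ℓ₀} ξ_E ≠ 0`), supplies by Čebotarev ((α)-frames), and leaves the complementary (β)-frames («the twin's Selmer generator IS the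
phantom») as the honest residual.  THIS FILE NAMES THE BIT: it is `a_{ℓ₀}(E) mod 4`.

WHAT (all inputs are tree theorems).
* §1 `frob_smul_frob_smul_eq_of_four_smul_eq_zero` — Cayley–Hamilton on `E[4]`: `F²P = a_ℓ·FP − ℓ·P` for `4P = 0` at a good odd place
  (`T_2 E` Cayley–Hamilton `GaloisImage.CyclotomicLevel.Rat.galoisRepTate_apply_apply_eq_of_hasGoodReductionAt` + surjectivity of
  `T_2E → E[4]`; JET brick B's pattern at `p = 2` without the Kolyvagin congruences); `two_dvd_frobeniusTrace_of_involution` — if `F` is an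
  involution `≠ 1` on `E[2]` then `a_ℓ` is even.
* §2 `coe_frob_mul_frob_smul_eq_add_datum` — the DATUM of `F²`: with `a_ℓ = 2a'`, `ℓ + 1 = 2c'`, `F²` acts on `E[4]` as `P ↦ P + A(2P)`,
  `A = a'·F + c'·1` on `E[2]` (the shape consumed by gk2-p5 g42's `LevelTwoValues`).
* §3 ★ `h1Eval_frob_mul_frob_eq_zero_iff_four_dvd_frobeniusTrace` — for `ρ̄_{W,2}`, `ρ_{W,4}` onto, `x ≠ 0` dying on `Γ_{ℚ(E[4])}`, `F` an
  arithmetic Frobenius at a good `ℓ ≠ 2` acting on `E[2]` as an involution `≠ 1`: **`[x, F·F] = 0 ⟺ 4 ∣ a_ℓ`** (gk2-p5's vanishing criterion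
  `[x, ρ] = 0 ⟺ datum ∈ 𝔽₂[ω]`, and `a'·F + c' ∈ 𝔽₂[ω] ⟺ a'` even, since a transposition lies outside `𝔽₂[ω]`).
* §4 ★★ `mem_torsionLocalKer_padic_iff_four_dvd_frobeniusTrace` — the local form **`x_ℓ = 0 in H¹(ℚ_ℓ, E[2]) ⟺ 4 ∣ a_ℓ`** (gk2-p4 g10 §52a/b
  transport: conjugate Frobenius at the prime cut out by `ℚ̄ → ℚ̄_v`, unramifiedness, gk2-p3's local criterion, `ℚ_v ≃ ℚ_ℓ`).
* §5 ★★★ the frame form in gk2-p3 g34's export currency (`F` acts on `E[2]` as a complex conjugation `c₀`, `Δ < 0`):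
  `h1Eval_frob_mul_frob_ne_zero_iff_of_smul_eq_complexConjugation` **`[x, F·F] ≠ 0 ⟺ ¬ 4 ∣ a_ℓ`** and
  `not_mem_torsionLocalKer_padic_iff_of_smul_eq_complexConjugation` **`x ∉ ker(loc_ℓ) ⟺ ¬ 4 ∣ a_ℓ`**.

READING (LINE 34 census; nothing closed).  On the K₄⁻ phantom cell with the 2-adic bit FALSE (`ξ_E ∈ Sel₂(E)`: good-supersingular at `2`
by LPF₂, the tested additive cells), the prime Heegner frames split by ONE Frobenius bit: (α) `a_{ℓ₀}(E) ≡ 2 (mod 4)` — `hDesc` holds, the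
LEAD + gk2-p3 road applies; (β) `4 ∣ a_{ℓ₀}(E)` (⟺ `Frob_{ℓ₀}² = 1` on `E[4]` ⟺, for `ℓ₀ ≡ 7 (8)`, `4 ∣ #Ẽ(𝔽_{ℓ₀})`) — `loc_{ℓ₀} ξ_E = 0`, the
twin's Selmer generator is the phantom, `hDesc` fails as stated.  Each class has Čebotarev density `1/2` among admissible `ℓ₀` (`ρ_{E,4}`
onto).  So the honest residual of the LEAD road on F4ᵖᵍ ∩ {bit FALSE} is the sub-cell «`4 ∣ a_{ℓ₀}(E)`», census-able per frame by one
point count.  BSD is NOT proved by any of this.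

References: [LawsonWuthrich2016] §3 (Lemma 6, Thm. 1), §7.1; [GrossLMS1991] §3 (3.2)–(3.3), §9 Prop. 9.1, 9.6; [McCallumLMS1991] §3 (3);
[MazurRubin2010] Prop. 3.3; [SilvermanAEC2009] Thm. V.2.3.1, C.21 Rem. 21.3, Prop. VII.4.1.
-/

set_option linter.dupNamespace false -- `Summit.<P>.<Sub>` repeats `BirchSwinnertonDyer` (D-0017)
set_option autoImplicit false

noncomputable section

open scoped Classical Pointwise

namespace Summit.BirchSwinnertonDyer.BirchSwinnertonDyer.Theorems.GenusExact.PhantomDescentBit.TraceBit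

open WeierstrassCurve Field NumberField IsDedekindDomain
open Literature.NumberTheory.GaloisRepresentations Literature.NumberTheory.EllipticCurves
open Literature.NumberTheory
open Rat.HeightOneSpectrum (primesEquiv)
open Summit.BirchSwinnertonDyer.BirchSwinnertonDyer.Theorems.GenusKolyTwistingPrime

/-! ## §1 Cayley–Hamilton on `E[4]`: `F²P = a_ℓ·FP − ℓ·P` -/

variable (W : WeierstrassCurve ℚ) [W.IsElliptic] [W.IsGloballyMinimal]

/-- **Cayley–Hamilton for an arithmetic Frobenius on `E[4]`.**  `W/ℚ` globally minimal, `v = (ℓ)` a place of good reduction with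
`ℓ ≠ 2`, `Fr ∈ Γ_ℚ` an arithmetic Frobenius at `v`, `P ∈ E(ℚ̄)` with `4P = 0`.  Then `Fr(Fr P) = a_ℓ·(Fr P) − ℓ·P`: the
characteristic polynomial `X² − a_ℓ X + ℓ` of `Fr` on `T_2 E` (tree `galoisRepTate_apply_apply_eq_of_hasGoodReductionAt`), pushed
to `E[4]` along the surjective projection `T_2 E → E[4]` (`proj_surjective_of_isAlgClosed_holds`) — JET brick B at `p = 2`, without
the Kolyvagin congruences. [cite: SilvermanAEC2009, Thm. V.2.3.1, C.21 Remark 21.3] [cite: GrossLMS1991, §3 (3.3)] -/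
theorem frob_smul_frob_smul_eq_of_four_smul_eq_zero {v : HeightOneSpectrum (𝓞 ℚ)}
    (hne : ((primesEquiv v : Nat.Primes) : ℕ) ≠ 2) (hv : W.HasGoodReductionAt v)
    {Fr : absoluteGaloisGroup ℚ} (hFr : IsArithFrobAtPlace ℚ v Fr)
    {P : geomPoints W} (hP : (4 : ℤ) • P = 0) :
    Fr • Fr • P = W.frobeniusTrace (primesEquiv v) • Fr • P - (((primesEquiv v : Nat.Primes) : ℕ) : ℤ) • P := by
  haveI : Fact (Nat.Prime 2) := ⟨Nat.prime_two⟩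
  have hP' : P ∈ geomTorsion W ((2 ^ 2 : ℕ) : ℤ) := by
    rw [WeierstrassCurve.mem_geomTorsion_iff]
    exact_mod_cast hP
  obtain ⟨t, ht⟩ := W.proj_surjective_of_isAlgClosed_holds 2 2 hP'
  have hCH := Summit.BirchSwinnertonDyer.Rank1Residual.GaloisImage.CyclotomicLevel.Rat.galoisRepTate_apply_apply_eq_of_hasGoodReductionAt
    W 2 hne hv hFr t
  have h := congrArg (fun s ↦ TateModule.proj 2 2 s) hCH
  simp only [galoisRepTate_apply_apply, map_sub, map_zsmul] at h
  simp only [TateModule.proj_smul_of_distribMulAction, ht] at h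
  exact h

/-- **Parity of `a_ℓ` at a transposition-type Frobenius.**  If `Fr² = 1 ≠ Fr` on `E[2]` (e.g. `Fr` acts on `E[2]` as a complex
conjugation, `Δ < 0`), then `a_ℓ` is even: on `E[2]`, Cayley–Hamilton reads `Q = Fr²Q = a_ℓ·FrQ − ℓ·Q = a_ℓ·FrQ + Q` (`ℓ` odd,
`2Q = 0`), so `a_ℓ·Q = 0` for every `Q ∈ E[2]`, and an odd `a_ℓ` would force `E[2] = 0`. [folklore] -/
theorem two_dvd_frobeniusTrace_of_involution {v : HeightOneSpectrum (𝓞 ℚ)}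
    (hne : ((primesEquiv v : Nat.Primes) : ℕ) ≠ 2) (hv : W.HasGoodReductionAt v)
    {Fr : absoluteGaloisGroup ℚ} (hFr : IsArithFrobAtPlace ℚ v Fr)
    (hinv : ∀ Q : geomTorsion W (2 : ℤ), Fr • Fr • Q = Q) (hne1 : ∃ Q : geomTorsion W (2 : ℤ), Fr • Q ≠ Q) :
    (2 : ℤ) ∣ W.frobeniusTrace (primesEquiv v) := by
  set q : ℕ := ((primesEquiv v : Nat.Primes) : ℕ) with hq
  have hqprime : q.Prime := (primesEquiv v).2
  have hqodd : Odd q := hqprime.odd_of_ne_two hne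
  by_contra hodd
  have haodd : Odd (W.frobeniusTrace (primesEquiv v)) :=
    Int.not_even_iff_odd.mp (fun h ↦ hodd (even_iff_two_dvd.mp h))
  have h2 : ∀ Q : geomTorsion W (2 : ℤ), (2 : ℤ) • (Q : geomPoints W) = 0 := fun Q ↦
    (WeierstrassCurve.mem_geomTorsion_iff W (2 : ℤ) _).mp Q.2
  -- every `Q ∈ E[2]` vanishes
  have hzero : ∀ Q : geomTorsion W (2 : ℤ), (Q : geomPoints W) = 0 := by
    intro Q
    have hFFQ : Fr • Fr • (Q : geomPoints W) = Q := by
      have h := congrArg Subtype.val (hinv Q)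
      simpa only [AddSubgroup.torsionBy.coe_smul] using h
    have h2F : (2 : ℤ) • Fr • (Q : geomPoints W) = 0 := by rw [smul_comm, h2, smul_zero]
    have h4 : (4 : ℤ) • Fr • (Q : geomPoints W) = 0 := by
      rw [show (4 : ℤ) = 2 * 2 by norm_num, mul_smul, h2F, smul_zero]
    have hCH := frob_smul_frob_smul_eq_of_four_smul_eq_zero W hne hv hFr h4
    rw [hFFQ] at hCH
    -- hCH : Fr • ↑Q = a • ↑Q - q • Fr • ↑Q, with `a`, `q` odd
    obtain ⟨a', ha'⟩ := haodd
    obtain ⟨q', hq'⟩ := hqodd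
    have hQ : W.frobeniusTrace (primesEquiv v) • (Q : geomPoints W) = Q := by
      rw [ha', add_smul, one_smul, mul_comm, mul_smul, h2, smul_zero, zero_add]
    have hFQ : (q : ℤ) • Fr • (Q : geomPoints W) = Fr • (Q : geomPoints W) := by
      rw [hq', Nat.cast_add, Nat.cast_mul, Nat.cast_two, Nat.cast_one, add_smul, one_smul, mul_comm, mul_smul, h2F,
        smul_zero, zero_add]
    rw [hQ, hFQ] at hCH
    -- hCH : Fr • ↑Q = ↑Q - Fr • ↑Q
    have h : (Q : geomPoints W) = (2 : ℤ) • Fr • (Q : geomPoints W) := by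
      rw [two_zsmul]
      nth_rewrite 1 [hCH]
      abel
    rw [h, h2F]
  obtain ⟨Q, hQ⟩ := hne1
  apply hQ
  apply Subtype.ext
  rw [hzero Q, hzero (Fr • Q)]

/-! ## §2 The datum of `Fr²` on `E[4]`: `Fr² = P ↦ P + A(2P)` with `A = (a_ℓ/2)·Fr + (ℓ+1)/2` on `E[2]` -/

/-- **THE DATUM OF `Fr²`.**  With `a_ℓ = 2a'` and `ℓ + 1 = 2c'`, the square of an arithmetic Frobenius at the good odd place
`v = (ℓ)` acts on `E[4]` as `P ↦ P + A(2P)` for the additive map `A = a'·Fr + c'·1` of `E[2]`: indeed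
`Fr²P = a_ℓ·FrP − ℓ·P = P + a'·Fr(2P) + c'·(2P) − (ℓ + 1 + 2c' − 2c')…`, i.e. `Fr²P − P − a'·Fr(2P) − c'·(2P) = −c'·(4P) = 0`.
This is the shape `hρ` consumed by gk2-p5 g42's level-2 value theorems (`LevelTwoValues.h1Eval_eq_zero_iff_of_datum`).
[cite: SilvermanAEC2009, Thm. V.2.3.1] [cite: LawsonWuthrich2016, §3] -/
theorem coe_frob_mul_frob_smul_eq_add_datum {v : HeightOneSpectrum (𝓞 ℚ)}
    (hne : ((primesEquiv v : Nat.Primes) : ℕ) ≠ 2) (hv : W.HasGoodReductionAt v)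
    {Fr : absoluteGaloisGroup ℚ} (hFr : IsArithFrobAtPlace ℚ v Fr) {a' c' : ℤ}
    (ha : W.frobeniusTrace (primesEquiv v) = 2 * a') (hc : (((primesEquiv v : Nat.Primes) : ℕ) : ℤ) + 1 = 2 * c')
    {A : geomTorsion W (2 : ℤ) →+ geomTorsion W (2 : ℤ)} (hA : ∀ T : geomTorsion W (2 : ℤ), A T = a' • Fr • T + c' • T)
    (P : geomTorsion W (4 : ℤ)) :
    (((Fr * Fr) • P : geomTorsion W (4 : ℤ)) : geomPoints W) =
      (P : geomPoints W) + (A ⟨(2 : ℤ) • (P : geomPoints W), two_zsmul_mem_geomTorsion_two W P⟩ : geomPoints W) := by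
  have hP4 : (4 : ℤ) • (P : geomPoints W) = 0 := (WeierstrassCurve.mem_geomTorsion_iff W (4 : ℤ) _).mp P.2
  have hCH := frob_smul_frob_smul_eq_of_four_smul_eq_zero W hne hv hFr hP4
  have hq : (((primesEquiv v : Nat.Primes) : ℕ) : ℤ) = 2 * c' - 1 := by linarith
  have hR : ((A ⟨(2 : ℤ) • (P : geomPoints W), two_zsmul_mem_geomTorsion_two W P⟩ : geomTorsion W (2 : ℤ)) : geomPoints W) =
      a' • (2 : ℤ) • Fr • (P : geomPoints W) + c' • (2 : ℤ) • (P : geomPoints W) := by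
    rw [hA]
    simp only [AddMemClass.coe_add, AddSubgroup.torsionBy.coe_smul, smul_comm Fr (2 : ℤ) (P : geomPoints W)]
  -- the scalar identity, with `Fr • P` as an atom
  have key : ∀ X Y : geomPoints W, (4 : ℤ) • X = 0 →
      (2 * a') • Y - (2 * c' - 1) • X = X + (a' • (2 : ℤ) • Y + c' • (2 : ℤ) • X) := by
    intro X Y h4
    have e : (2 * a') • Y - (2 * c' - 1) • X - (X + (a' • (2 : ℤ) • Y + c' • (2 : ℤ) • X)) = -(c' • ((4 : ℤ) • X)) := by
      module
    rw [h4, smul_zero, neg_zero, sub_eq_zero] at e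
    exact e
  rw [AddSubgroup.torsionBy.coe_smul, mul_smul, hCH, hR, ha, hq]
  exact key _ _ hP4

/-! ## §3 ★ THE TRACE BIT: `[x, Fr·Fr] = 0 ⟺ 4 ∣ a_ℓ` -/

omit [W.IsElliptic] [W.IsGloballyMinimal] in
/-- In `E[2]`: if `Fr² = 1` and `Fr Q₀ ≠ Q₀`, then `Fr Q₀ ≠ 0`, `Q₀ ≠ 0` and `Fr Q₀ + Q₀ ≠ 0`. [folklore] -/
theorem frob_smul_ne_aux {Fr : absoluteGaloisGroup ℚ} (hinv : ∀ Q : geomTorsion W (2 : ℤ), Fr • Fr • Q = Q)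
    {Q₀ : geomTorsion W (2 : ℤ)} (hQ₀ : Fr • Q₀ ≠ Q₀) :
    Fr • Q₀ ≠ 0 ∧ Q₀ ≠ 0 ∧ Fr • Q₀ + Q₀ ≠ 0 := by
  refine ⟨fun h ↦ hQ₀ ?_, fun h ↦ hQ₀ ?_, fun h ↦ hQ₀ ?_⟩
  · have hQ : Q₀ = 0 := by rw [← hinv Q₀, h, smul_zero]
    rw [hQ, smul_zero]
  · rw [h, smul_zero]
  · rw [eq_neg_of_add_eq_zero_left h, neg_eq_self_geomTorsion_two]

/-- ★ **THE TRACE BIT.**  `W/ℚ` globally minimal with `ρ̄_{W,2}` and `ρ_{W,4}` onto; `x ∈ H¹(ℚ, E[2])` non-zero and dying on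
`Γ_{ℚ(E[4])}` (the Lawson–Wuthrich class `ξ_E`); `v = (ℓ)` a place of good reduction, `ℓ ≠ 2`, `Fr` an arithmetic Frobenius at `v` acting
on `E[2]` as an involution `≠ 1` (a transposition — e.g. as complex conjugation when `Δ < 0`: every prime Heegner frame `ℓ₀ = −d_K` of the
K₄⁻ cell).  Then `Fr·Fr ∈ Γ_{ℚ(E[2])}` and **`[x, Fr·Fr] = 0 ⟺ 4 ∣ a_ℓ(W)`.**  Proof: by §2, `Fr²` acts on `E[4]` with datum
`A = a'·Fr + c'·1` (`a_ℓ = 2a'`, `ℓ + 1 = 2c'`); by gk2-p5 g42's vanishing criterion `[x, Fr²] = 0 ⟺ A ∈ 𝔽₂[ω] = {0, 1, ω, ω²}`; on `E[2]`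
the scalar `c'` is `0` or `1` and a transposition `Fr` has `Fr, Fr + 1 ∉ 𝔽₂[ω]` (`Fr ≠ 0, 1`; `Fr² + Fr + 1 = Fr ≠ 0`;
`(Fr + 1)² + (Fr + 1) + 1 = Fr ≠ 0`), so `A ∈ 𝔽₂[ω]` iff `a'` is even.  READING: gk2-p3 g34's (α)-frames («`[ξ_E, F·F] ≠ 0`», `hDesc`
holds) are EXACTLY «`a_{ℓ₀} ≡ 2 (mod 4)`»; the residual (β)-frames are EXACTLY «`4 ∣ a_{ℓ₀}`».  BSD / `K4Neg` NOT proved by this.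
[cite: LawsonWuthrich2016, §3 (Lemma 6, Thm. 1), §7.1] [cite: GrossLMS1991, §3 (3.3), §9 Prop. 9.1, 9.6] [cite: SilvermanAEC2009, Thm. V.2.3.1] -/
theorem h1Eval_frob_mul_frob_eq_zero_iff_four_dvd_frobeniusTrace
    (hsurj : W.HasSurjectiveModNGaloisRep 2) (hsurj4 : W.HasSurjectiveModNGaloisRep 4)
    {x : galH1Torsion W (2 : ℤ)} (hx0 : x ≠ 0) (hx : ∀ h ∈ torsionFixing W (4 : ℤ), h1Eval W (2 : ℤ) x h = 0)
    {v : HeightOneSpectrum (𝓞 ℚ)} (hne : ((primesEquiv v : Nat.Primes) : ℕ) ≠ 2) (hv : W.HasGoodReductionAt v)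
    {Fr : absoluteGaloisGroup ℚ} (hFr : IsArithFrobAtPlace ℚ v Fr)
    (hinv : ∀ Q : geomTorsion W (2 : ℤ), Fr • Fr • Q = Q) (hne1 : ∃ Q : geomTorsion W (2 : ℤ), Fr • Q ≠ Q) :
    Fr * Fr ∈ torsionFixing W (2 : ℤ) ∧
      (h1Eval W (2 : ℤ) x (Fr * Fr) = 0 ↔ (4 : ℤ) ∣ W.frobeniusTrace (primesEquiv v)) := by
  classical
  have hFF : Fr * Fr ∈ torsionFixing W (2 : ℤ) := by
    rw [mem_torsionFixing_iff]
    intro Q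
    rw [mul_smul, hinv Q]
  refine ⟨hFF, ?_⟩
  -- `a_ℓ = 2a'`, `ℓ + 1 = 2c'`
  obtain ⟨a', ha'⟩ := two_dvd_frobeniusTrace_of_involution W hne hv hFr hinv hne1
  have hqodd : Odd ((primesEquiv v : Nat.Primes) : ℕ) := (primesEquiv v).2.odd_of_ne_two hne
  obtain ⟨c'', hc''⟩ := hqodd
  set c' : ℤ := (c'' : ℤ) + 1 with hc'def
  have hc : (((primesEquiv v : Nat.Primes) : ℕ) : ℤ) + 1 = 2 * c' := by
    rw [hc'']; push_cast; ring
  -- the datum `A = a'·Fr + c'·1`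
  let A : geomTorsion W (2 : ℤ) →+ geomTorsion W (2 : ℤ) :=
    AddMonoidHom.mk' (fun T ↦ a' • Fr • T + c' • T) (fun T T' ↦ by rw [smul_add, smul_add, smul_add]; abel)
  have hA : ∀ T : geomTorsion W (2 : ℤ), A T = a' • Fr • T + c' • T := fun T ↦ rfl
  have hρ := coe_frob_mul_frob_smul_eq_add_datum W hne hv hFr ha' hc hA
  rw [Lw2PhantomExclusion.LevelTwoValues.h1Eval_eq_zero_iff_of_datum W hsurj hsurj4 hx0 hx hρ, ha']
  -- ### the finite analysis on `E[2]`
  have h2T : ∀ T : geomTorsion W (2 : ℤ), (2 : ℤ) • T = 0 := fun T ↦ by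
    have h := AddSubgroup.torsionBy.nsmul T
    rwa [← natCast_zsmul] at h
  have hsmul : ∀ (n k : ℤ) (T : geomTorsion W (2 : ℤ)), (2 * k + n) • T = n • T := fun n k T ↦ by
    rw [add_smul, mul_comm, mul_smul, h2T, smul_zero, zero_add]
  obtain ⟨Q₀, hQ₀⟩ := hne1
  obtain ⟨hF0, hQ0, hF1⟩ := frob_smul_ne_aux W hinv hQ₀
  rcases Int.even_or_odd' a' with ⟨k, hk | hk⟩
  · -- `a'` even: `A = c'·1 ∈ {0, 1}`, and `4 ∣ a_ℓ`
    have h4 : (4 : ℤ) ∣ 2 * a' := ⟨k, by rw [hk]; ring⟩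
    refine ⟨fun _ ↦ h4, fun _ ↦ ?_⟩
    have hAc : ∀ T, A T = c' • T := fun T ↦ by
      rw [hA, hk, mul_smul, smul_comm, h2T, smul_zero]; exact zero_add _
    rcases Int.even_or_odd' c' with ⟨m, hm | hm⟩
    · refine Or.inl (AddMonoidHom.ext fun T ↦ ?_)
      rw [hAc, hm, mul_smul, h2T, AddMonoidHom.zero_apply]
    · refine Or.inr (Or.inl (AddMonoidHom.ext fun T ↦ ?_))
      rw [hAc, hm, hsmul, one_smul, AddMonoidHom.id_apply]
  · -- `a'` odd: `A = Fr + c'·1 ∉ 𝔽₂[ω]`, and `4 ∤ a_ℓ`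
    have h4 : ¬ (4 : ℤ) ∣ 2 * a' := by rw [hk]; omega
    refine ⟨fun h ↦ absurd h ?_, fun h ↦ absurd h h4⟩
    have hAc : ∀ T, A T = Fr • T + c' • T := fun T ↦ by rw [hA, hk, hsmul, one_smul]
    rcases Int.even_or_odd' c' with ⟨m, hm | hm⟩
    · -- `A = Fr`
      have hAF : ∀ T, A T = Fr • T := fun T ↦ by rw [hAc, hm, mul_smul, h2T, add_zero]
      rintro (h | h | h)
      · exact hF0 (by rw [← hAF, h, AddMonoidHom.zero_apply])
      · exact hQ₀ (by rw [← hAF, h, AddMonoidHom.id_apply])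
      · have h' := DFunLike.congr_fun h Q₀
        rw [AddMonoidHom.add_apply, AddMonoidHom.add_apply, AddMonoidHom.comp_apply, hAF, hAF, hinv,
          AddMonoidHom.id_apply, AddMonoidHom.zero_apply, add_assoc, add_comm, add_assoc, ← two_nsmul,
          ← natCast_zsmul, Nat.cast_ofNat, h2T, add_zero] at h'
        exact hF0 h'
    · -- `A = Fr + 1`
      have hAF : ∀ T, A T = Fr • T + T := fun T ↦ by rw [hAc, hm, hsmul, one_smul]
      rintro (h | h | h)
      · exact hF1 (by rw [← hAF, h, AddMonoidHom.zero_apply])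
      · have h' := DFunLike.congr_fun h Q₀
        rw [hAF, AddMonoidHom.id_apply, add_eq_right] at h'
        exact hF0 h'
      · have h' := DFunLike.congr_fun h Q₀
        have hAA : A (A Q₀) = 0 := by
          rw [hAF, hAF, smul_add, hinv, add_add_add_comm, add_comm (Fr • Q₀) Q₀, ← two_nsmul, ← natCast_zsmul,
            Nat.cast_ofNat, h2T]
        rw [AddMonoidHom.add_apply, AddMonoidHom.add_apply, AddMonoidHom.comp_apply, hAA, zero_add, hAF,
          AddMonoidHom.id_apply, AddMonoidHom.zero_apply, add_assoc, ← two_nsmul, ← natCast_zsmul, Nat.cast_ofNat, h2T,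
          add_zero] at h'
        exact hF0 h'

/-! ## §4 ★★ The local form: `loc_ℓ x = 0 ⟺ 4 ∣ a_ℓ` -/

/-- ★★ **THE TRACE BIT, LOCAL FORM: `x_ℓ = 0` in `H¹(ℚ_ℓ, E[2])` iff `4 ∣ a_ℓ`.**  `W/ℚ` globally minimal with `ρ̄_{W,2}`, `ρ_{W,4}` onto;
`x ≠ 0` in `H¹(ℚ, E[2])` dying on `Γ_{ℚ(E[4])}` (the Lawson–Wuthrich class); `ℓ ≠ 2` a prime of good reduction (`v` its place,
`𝔓₀ ∣ v` any prime of `\bar ℤ`, `γ` an arithmetic Frobenius at `𝔓₀`) acting on `E[2]` as an involution `≠ 1`.  Then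
**`x ∈ ker(H¹(ℚ, E[2]) → H¹(ℚ_ℓ, E[2])) ⟺ 4 ∣ a_ℓ(W)`** — and otherwise (`a_ℓ ≡ 2 (mod 4)`) `x_ℓ ≠ 0`.
Proof = gk2-p4 g10 §52b's transport (conjugate `γ` to the prime cut out by `ℚ̄ → ℚ̄_v`; `x` is unramified since inertia fixes `E[4]`;
gk2-p3's local criterion `x_v = 0 ⟺ [x, F] ∈ (F − 1)E[2]`; §52a `⟺ [x, F²] = 0`) + the trace bit §3 + `ℚ_v ≃ ℚ_ℓ`.
READING (K₄⁻ phantom cell, prime Heegner frame `K = ℚ(√−ℓ₀)`): «`loc_{ℓ₀} ξ_E = 0`» (gk2-p3 g34's (β)-frames, where the twin's Selmer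
generator IS the phantom and `hDesc` fails) ⟺ `4 ∣ a_{ℓ₀}(E)`; the (α)-frames are `a_{ℓ₀} ≡ 2 (mod 4)`.  BSD is NOT proved by this.
[cite: GrossLMS1991, §9 Prop. 9.6] [cite: McCallumLMS1991, §3 (3)] [cite: LawsonWuthrich2016, §3, §7.1] [cite: SilvermanAEC2009, Prop. VII.4.1, Thm. V.2.3.1] -/
theorem mem_torsionLocalKer_padic_iff_four_dvd_frobeniusTrace
    (hsurj : W.HasSurjectiveModNGaloisRep 2) (hsurj4 : W.HasSurjectiveModNGaloisRep 4)
    {x : galH1Torsion W (2 : ℤ)} (hx0 : x ≠ 0) (hx : ∀ h ∈ torsionFixing W (4 : ℤ), h1Eval W (2 : ℤ) x h = 0)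
    {ℓ : ℕ} [Fact ℓ.Prime] (hℓ2 : ℓ ≠ 2)
    {v : HeightOneSpectrum (𝓞 ℚ)} (hℓv : (ℓ : 𝓞 ℚ) ∈ v.asIdeal) (hW : W.HasGoodReductionAt v)
    {𝔓₀ : Ideal (absIntegers (𝓞 ℚ) ℚ)} (h𝔓₀ : 𝔓₀ ∈ v.primesAbove) {γ : absoluteGaloisGroup ℚ}
    (hγ : IsArithFrobAt (𝓞 ℚ) γ 𝔓₀)
    (hinv : ∀ T : geomTorsion W (2 : ℤ), γ • γ • T = T) (hγT : ∃ T : geomTorsion W (2 : ℤ), γ • T ≠ T) :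
    x ∈ W.torsionLocalKer ℚ_[ℓ] (2 : ℤ) ↔ (4 : ℤ) ∣ W.frobeniusTrace ℓ := by
  classical
  have hℓ : ℓ.Prime := Fact.out
  have hvℓ : ((primesEquiv v : Nat.Primes) : ℕ) = ℓ := primesEquiv_eq hℓ hℓv
  subst hvℓ
  letI : Algebra ℚ (v.adicCompletion ℚ) := inferInstance
  haveI : CharZero (v.adicCompletion ℚ) := Literature.NumberTheory.GaloisRepresentations.charZero_adicCompletion v
  have hvbad : v ∉ W.badPlaces (𝓞 ℚ) := fun h ↦ h hW
  -- `ℓ ∤ 2`, `ℓ ∤ 4`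
  have hℓ2' : ¬ ((primesEquiv v : Nat.Primes) : ℕ) ∣ 2 := fun h ↦
    hℓ2 ((Nat.prime_dvd_prime_iff_eq hℓ Nat.prime_two).mp h)
  have hℓ4 : ¬ ((primesEquiv v : Nat.Primes) : ℕ) ∣ 4 := fun h ↦
    hℓ2' (hℓ.dvd_of_dvd_pow (show ((primesEquiv v : Nat.Primes) : ℕ) ∣ 2 ^ 2 by simpa using h))
  have h2v : ((2 : ℤ) : 𝓞 ℚ) ∉ v.asIdeal := by
    have h := natCast_not_mem_of_not_dvd hℓ hℓv hℓ2'
    rw [Nat.cast_ofNat] at h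
    rw [Int.cast_ofNat]
    exact h
  have h4v : ((4 : ℤ) : 𝓞 ℚ) ∉ v.asIdeal := by
    have h := natCast_not_mem_of_not_dvd hℓ hℓv hℓ4
    rw [Nat.cast_ofNat] at h
    rw [Int.cast_ofNat]
    exact h
  -- the prime of `\bar ℤ` cut out by `ℚ̄ → ℚ̄_v`, and a Frobenius there (a conjugate of `γ`)
  obtain ⟨𝔐, h𝔐⟩ := v.localPrimesAbove_nonempty
  set 𝔓w := v.primeBelow (closureEmb (K := ℚ) (v.adicCompletion ℚ)) 𝔐 with h𝔓w_def
  have h𝔓w : 𝔓w ∈ v.primesAbove := v.primeBelow_mem_primesAbove h𝔐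
  obtain ⟨δ, -, hF⟩ := HeightOneSpectrum.exists_isArithFrobAt_conj_of_mem_primesAbove_holds h𝔓₀ h𝔓w hγ
  have hFinv : ∀ T : geomTorsion W (2 : ℤ), (δ * γ * δ⁻¹) • (δ * γ * δ⁻¹) • T = T := fun T ↦ by
    rw [mul_smul, mul_smul, mul_smul, mul_smul, inv_smul_smul, hinv, smul_inv_smul]
  have hFT : ∃ T : geomTorsion W (2 : ℤ), (δ * γ * δ⁻¹) • T ≠ T := by
    obtain ⟨T, hT⟩ := hγT
    refine ⟨δ • T, fun h ↦ hT ?_⟩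
    rw [mul_smul, mul_smul, inv_smul_smul] at h
    exact smul_left_cancel δ h
  have hFr : IsArithFrobAtPlace ℚ v (δ * γ * δ⁻¹) := ⟨𝔓w, h𝔓w, hF⟩
  -- inertia at `v` fixes `E[2]` and `E[4]`; `x` is unramified at `𝔓w`
  have hI : 𝔓w.inertia (absoluteGaloisGroup ℚ) ≤ torsionFixing W (2 : ℤ) := inertia_le_torsionFixing W hvbad h2v _ h𝔐
  have hI4 : 𝔓w.inertia (absoluteGaloisGroup ℚ) ≤ torsionFixing W (4 : ℤ) := inertia_le_torsionFixing W hvbad h4v _ h𝔐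
  have hxur : x ∈ unramifiedKer (geomTorsion W (2 : ℤ)) 𝔓w := by
    rw [← oneCocycleClass_reprCocycle W (2 : ℤ) x]
    refine (oneCocycleClass_mem_subgroupResKer_iff _ _).mpr ⟨0, fun τ ↦ ?_⟩
    rw [smul_zero, sub_zero]
    exact hx _ (hI4 τ.2)
  -- `ℚ_ℓ ≃ ℚ_v`, the local criterion at `δγδ⁻¹`, the coboundary/square dictionary, and the trace bit
  rw [mem_torsionLocalKer_padic_iff W
      (RingEquivClass.toRingEquiv (Rat.HeightOneSpectrum.adicCompletion.padicEquiv (R := 𝓞 ℚ) v)) (2 : ℤ) x,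
    GenusExact.FrobeniusCriterion.mem_torsionLocalKer_iff_exists_h1Eval_eq_smul_sub W (2 : ℤ) h𝔐 hF hI
      (isOpen_torsionFixing W two_ne_zero) (torsionPointsMap_bijective W (v.adicCompletion ℚ) (n := 2) two_ne_zero).2 hxur,
    exists_h1Eval_eq_smul_sub_iff_h1Eval_mul_self_eq_zero W x hFinv hFT]
  exact (h1Eval_frob_mul_frob_eq_zero_iff_four_dvd_frobeniusTrace W hsurj hsurj4 hx0 hx hℓ2 hW hFr hFinv hFT).2

/-! ## §5 The frame form: at a prime Heegner frame (Frobenius = complex conjugation on `E[2]`), (α) ⟺ `a_ℓ ≡ 2 (4)`, (β) ⟺ `4 ∣ a_ℓ` -/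

/-- ★★★ **THE DESCENT BIT OF THE PHANTOM CELL IS `a_{ℓ₀} mod 4`** — in the exact currency exported by gk2-p3 g34's
`PhantomDescentBit.exists_levelFour_phantom_twistingPrime` / `exists_twistingPrime_h1Eval_sq_ne_zero_heegner`.  `W/ℚ` globally
minimal, `Δ < 0`, `ρ̄_{W,2}` and `ρ_{W,4}` onto; `x ≠ 0` in `H¹(ℚ, E[2])` dying on `Γ_{ℚ(E[4])}` (the Lawson–Wuthrich class `ξ_E`);
`c₀` a complex conjugation; `v = (ℓ)` a place of good reduction, `ℓ ≠ 2`, `𝔓 ∣ v`, `F` an arithmetic Frobenius at `𝔓` acting on `E[2]`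
as `c₀` (the shape at every prime Heegner frame `ℓ = ℓ₀ = −d_K`, `Frob_{ℓ₀} = Frob_∞` on `ℚ(E[2])`).  Then `F·F ∈ Γ_{ℚ(E[2])}` and
**`[x, F·F] ≠ 0 ⟺ ¬ 4 ∣ a_ℓ(W)`** (⟺ `a_ℓ ≡ 2 (mod 4)`, `a_ℓ` being even by §1); equivalently (§4) `x_ℓ ≠ 0 ⟺ a_ℓ ≡ 2 (mod 4)`.
So gk2-p3's (α)-frames («`[ξ_E, F·F] ≠ 0`», where `hDesc` holds and the LEAD g28 road closes the K₄⁻ conclusion shape) are the frames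
with `a_{ℓ₀}(E) ≡ 2 (mod 4)`, and the residual (β)-frames are those with `4 ∣ a_{ℓ₀}(E)` — one `ellap` per frame; Čebotarev density
`1/2` each among the admissible `ℓ₀` (the cosets `c̃₀·(1 + 2A)`, `A ∈ M₂(𝔽₂)`, split evenly by `tr A_V`).  BSD is NOT proved by this;
`K4Neg` is NOT proved by this. [cite: LawsonWuthrich2016, §3, §7.1] [cite: GrossLMS1991, §3 (3.2)–(3.3), §9 Prop. 9.6]
[cite: MazurRubin2010, Prop. 3.3] [cite: SilvermanAEC2009, Thm. V.2.3.1] -/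
theorem h1Eval_frob_mul_frob_ne_zero_iff_of_smul_eq_complexConjugation
    (hsurj : W.HasSurjectiveModNGaloisRep 2) (hsurj4 : W.HasSurjectiveModNGaloisRep 4) (hΔ : W.Δ < 0)
    {x : galH1Torsion W (2 : ℤ)} (hx0 : x ≠ 0) (hx : ∀ h ∈ torsionFixing W (4 : ℤ), h1Eval W (2 : ℤ) x h = 0)
    {c₀ : absoluteGaloisGroup ℚ} (hc₀ : IsComplexConjugation (Rat.castHom ℝ) c₀)
    {v : HeightOneSpectrum (𝓞 ℚ)} (hne : ((primesEquiv v : Nat.Primes) : ℕ) ≠ 2) (hv : W.HasGoodReductionAt v)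
    {𝔓 : Ideal (absIntegers (𝓞 ℚ) ℚ)} (h𝔓 : 𝔓 ∈ v.primesAbove) {F : absoluteGaloisGroup ℚ} (hF : IsArithFrobAt (𝓞 ℚ) F 𝔓)
    (hFc : ∀ P : geomTorsion W (2 : ℤ), F • P = c₀ • P) :
    F * F ∈ torsionFixing W (2 : ℤ) ∧
      (h1Eval W (2 : ℤ) x (F * F) ≠ 0 ↔ ¬ (4 : ℤ) ∣ W.frobeniusTrace (primesEquiv v)) := by
  have hsq : c₀ * c₀ = 1 := by have h := hc₀.sq_eq_one; rwa [sq] at h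
  have hinv : ∀ Q : geomTorsion W (2 : ℤ), F • F • Q = Q := fun Q ↦ by
    rw [hFc, hFc, ← mul_smul, hsq, one_smul]
  have hne1 : ∃ Q : geomTorsion W (2 : ℤ), F • Q ≠ Q := by
    obtain ⟨Q, hQ⟩ := KolyvaginEigenTwo.exists_twoTorsion_smul_ne_of_Δ_neg W hΔ hc₀
    exact ⟨Q, fun h ↦ hQ (by rw [← hFc, h])⟩
  obtain ⟨hFF, hiff⟩ := h1Eval_frob_mul_frob_eq_zero_iff_four_dvd_frobeniusTrace W hsurj hsurj4 hx0 hx hne hv ⟨𝔓, h𝔓, hF⟩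
    hinv hne1
  exact ⟨hFF, not_congr hiff⟩

/-- **The frame form, local reading**: under the same hypotheses with `ℓ` the rational prime under `v`,
**`x ∉ ker(H¹(ℚ, E[2]) → H¹(ℚ_ℓ, E[2])) ⟺ ¬ 4 ∣ a_ℓ(W)`** — gk2-p3 g34's export «`ξ ∉ W.torsionLocalKer ℚ_[ℓ] 2`» at an
(α)-frame, now NAMED by the trace; at a (β)-frame (`4 ∣ a_{ℓ₀}`) the Lawson–Wuthrich class is locally trivial at `ℓ₀`.
BSD is NOT proved by this. [cite: GrossLMS1991, §9 Prop. 9.6] [cite: LawsonWuthrich2016, §7.1] -/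
theorem not_mem_torsionLocalKer_padic_iff_of_smul_eq_complexConjugation
    (hsurj : W.HasSurjectiveModNGaloisRep 2) (hsurj4 : W.HasSurjectiveModNGaloisRep 4) (hΔ : W.Δ < 0)
    {x : galH1Torsion W (2 : ℤ)} (hx0 : x ≠ 0) (hx : ∀ h ∈ torsionFixing W (4 : ℤ), h1Eval W (2 : ℤ) x h = 0)
    {c₀ : absoluteGaloisGroup ℚ} (hc₀ : IsComplexConjugation (Rat.castHom ℝ) c₀)
    {ℓ : ℕ} [Fact ℓ.Prime] (hℓ2 : ℓ ≠ 2)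
    {v : HeightOneSpectrum (𝓞 ℚ)} (hℓv : (ℓ : 𝓞 ℚ) ∈ v.asIdeal) (hv : W.HasGoodReductionAt v)
    {𝔓 : Ideal (absIntegers (𝓞 ℚ) ℚ)} (h𝔓 : 𝔓 ∈ v.primesAbove) {F : absoluteGaloisGroup ℚ} (hF : IsArithFrobAt (𝓞 ℚ) F 𝔓)
    (hFc : ∀ P : geomTorsion W (2 : ℤ), F • P = c₀ • P) :
    x ∉ W.torsionLocalKer ℚ_[ℓ] (2 : ℤ) ↔ ¬ (4 : ℤ) ∣ W.frobeniusTrace ℓ := by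
  have hsq : c₀ * c₀ = 1 := by have h := hc₀.sq_eq_one; rwa [sq] at h
  have hinv : ∀ Q : geomTorsion W (2 : ℤ), F • F • Q = Q := fun Q ↦ by
    rw [hFc, hFc, ← mul_smul, hsq, one_smul]
  have hne1 : ∃ Q : geomTorsion W (2 : ℤ), F • Q ≠ Q := by
    obtain ⟨Q, hQ⟩ := KolyvaginEigenTwo.exists_twoTorsion_smul_ne_of_Δ_neg W hΔ hc₀
    exact ⟨Q, fun h ↦ hQ (by rw [← hFc, h])⟩
  exact not_congr (mem_torsionLocalKer_padic_iff_four_dvd_frobeniusTrace W hsurj hsurj4 hx0 hx hℓ2 hℓv hv h𝔓 hF hinv hne1)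

end Summit.BirchSwinnertonDyer.BirchSwinnertonDyer.Theorems.GenusExact.PhantomDescentBit.TraceBit

end
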